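import Literature.NumberTheory.EllipticCurves.ZpExtensionEisensteinTwistDualityForm
import Literature.NumberTheory.EllipticCurves.ZpExtensionEisensteinTwistDualPerfect
import HarnessLib

/-!
# The dual family of `A_{m,k}` is a DUALIZING family for the tail form: `x ↦ (λ_k([πᵢ^*] x))_i` is bijective

Topic `NumberTheory/EllipticCurves` (sequel to `IwasawaAlgebraEisensteinQuotientDuality` (`tailFormZMod`,
`tailPairingZMod_bijective`), `ZpExtensionEisensteinTwistDualPerfect` (`EisensteinCoeff.dualFamily`,
`tailFormZMod_dualFamily_mul_mk_X_pow`, `exists_eq_sum_nsmul_dualFamily`) and `ZpExtensionEisensteinTwistDualityForm`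
(`EisensteinCoeff.ofZMod`, `tailFormZMod_ofZMod_mul`)).  Theorems only; no definition, no named fact, no instance,
no `sorry`.

For the level ring `A_{m,k} = Λ/(T^m + p, p^k)` with tail form `λ_k : A_{m,k} → ℤ/p^k` and dual family
`dᵢ = [πᵢ^*]` (`λ_k(dᵢ [T^j]) = δ_{ij}`):

* `EisensteinCoeff.tailFormZMod_dualFamily_mul_sum` — `λ_k(dᵢ · Σ_j ι(c_j)[T^j]) = c_i` (coordinates);
* **`EisensteinCoeff.bijective_tailFormZMod_dualFamily_mul`** — `x ↦ (λ_k(dᵢ x))_{i<m} : A_{m,k} → (ℤ/p^k)^m` is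
  bijective (injective: the `dᵢ` generate `A_{m,k}` additively and `λ_k` is non-degenerate; surjective: the
  coordinates above), i.e. `A_{m,k} ≅ ⊕_i ℤ/p^k` through the characters `λ_k(dᵢ ·)`;
* **`EisensteinCoeff.bijective_comp_tailFormZMod_dualFamily_mul`** — the same after any bijective `exp : ℤ/p^k → G`
  (a primitive `p^k`-th root of unity: `A_{m,k}(1) ≅ Π_i μ_{p^k}`): EXACTLY the hypothesis `hbij` of
  `Howard2004.DualityDatum.localTwoDetects_of_bijective` / `isSelfOrthogonalAt_of_unramified_of_bijective`
  (`Howard2004/UnramifiedSelfOrthogonalReadout.lean`) for the Eisenstein levels — the `H²`-readout of Howard's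
  `R(1)`-valued local pairing at `R = A_{m,k}` (H.4 at the places `v ∤ pN`, cell `pub/bsd-print-x9`).

BSD is not proved by any of this.

References: [Howard2004HeegnerKolyvagin] B. Howard, Compositio Math. 140 (2004), §2.1 («`Hom_{S_𝔭}(N, 𝒟_𝔭(1)) ≅
Hom_{ℤ_p}(N, μ_{p^∞})`»), §2.2; [DeSmitRubinSchoof1997] Cor. 2.2 (dual basis of a monogenic algebra);
[Washington1997] §13.2.
-/

noncomputable section

open Function

namespace Literature.NumberTheory.EllipticCurves.IwasawaAlgebra

open Literature.RingTheory.CompleteIntersection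

variable (p : ℕ) [hp : Fact p.Prime] {m : ℕ} (hm : 1 ≤ m) (k : ℕ)

/-- **Coordinates**: `λ_k(dᵢ · Σ_j ι(c_j) [T^j]) = c_i`. [cite: DeSmitRubinSchoof1997, Cor. 2.2 (case n = 1)]
[cite: Howard2004HeegnerKolyvagin, §2.1 and §2.2] -/
theorem EisensteinCoeff.tailFormZMod_dualFamily_mul_sum (c : Fin m → ZMod (p ^ k)) (i : Fin m) :
    EisensteinCoeff.tailFormZMod p hm k (EisensteinCoeff.dualFamily p hm k i *
      ∑ j : Fin m, EisensteinCoeff.ofZMod p hm k (c j) *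
        Ideal.Quotient.mk _ ((PowerSeries.X : IwasawaAlgebra p) ^ (j : ℕ))) = c i := by
  rw [Finset.mul_sum, map_sum]
  have h : ∀ j : Fin m, EisensteinCoeff.tailFormZMod p hm k (EisensteinCoeff.dualFamily p hm k i *
      (EisensteinCoeff.ofZMod p hm k (c j) * Ideal.Quotient.mk _ ((PowerSeries.X : IwasawaAlgebra p) ^ (j : ℕ)))) =
      if j = i then c i else 0 := fun j => by
    rw [mul_left_comm, EisensteinCoeff.tailFormZMod_ofZMod_mul, EisensteinCoeff.tailFormZMod_dualFamily_mul_mk_X_pow]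
    split_ifs with hji
    · rw [hji, mul_one]
    · rw [mul_zero]
  simp_rw [h]
  rw [Finset.sum_ite_eq' Finset.univ i, if_pos (Finset.mem_univ i)]

/-- **`x ↦ (λ_k(dᵢ x))_i : A_{m,k} → (ℤ/p^k)^m` is bijective** — the dual family is a DUALIZING family of characters
of `A_{m,k}`. [cite: Howard2004HeegnerKolyvagin, §2.1 and §2.2] [cite: DeSmitRubinSchoof1997, Cor. 2.2 (case n = 1)] -/
theorem EisensteinCoeff.bijective_tailFormZMod_dualFamily_mul :
    Bijective fun x : EisensteinCoeff p m k => fun i : Fin m =>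
      EisensteinCoeff.tailFormZMod p hm k (EisensteinCoeff.dualFamily p hm k i * x) := by
  constructor
  · -- injective: an additive map with trivial kernel
    intro x y hxy
    rw [← sub_eq_zero]
    refine EisensteinCoeff.eq_zero_of_forall_tailFormZMod_mul_eq_zero p hm k fun a => ?_
    obtain ⟨nn, rfl⟩ := EisensteinCoeff.exists_eq_sum_nsmul_dualFamily p hm k a
    rw [mul_comm, Finset.sum_mul, map_sum]
    refine Finset.sum_eq_zero fun i _ => ?_
    have hi : EisensteinCoeff.tailFormZMod p hm k (EisensteinCoeff.dualFamily p hm k i * x) =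
        EisensteinCoeff.tailFormZMod p hm k (EisensteinCoeff.dualFamily p hm k i * y) := congrFun hxy i
    rw [smul_mul_assoc, map_nsmul, mul_sub, map_sub, hi, sub_self, smul_zero]
  · intro c
    exact ⟨∑ j : Fin m, EisensteinCoeff.ofZMod p hm k (c j) *
        Ideal.Quotient.mk _ ((PowerSeries.X : IwasawaAlgebra p) ^ (j : ℕ)),
      funext fun i => EisensteinCoeff.tailFormZMod_dualFamily_mul_sum p hm k c i⟩

/-- **`A_{m,k}(1) ≅ Π_i μ_{p^k}` through the characters `exp ∘ λ_k(dᵢ ·)`**: for any bijective `exp : ℤ/p^k → G`,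
`x ↦ (exp (λ_k(dᵢ x)))_i` is bijective — the hypothesis `hbij` of `Howard2004.DualityDatum.localTwoDetects_of_bijective`
for the level ring `R = A_{m,k}` with `λ = λ_k` (as an additive map) and `r = dualFamily`.
[cite: Howard2004HeegnerKolyvagin, §2.1 and §2.2] -/
theorem EisensteinCoeff.bijective_comp_tailFormZMod_dualFamily_mul {G : Type*} [AddCommGroup G]
    (exp : ZMod (p ^ k) →+ G) (hexp : Bijective exp) :
    Bijective fun x : EisensteinCoeff p m k => fun i : Fin m =>
      exp ((EisensteinCoeff.tailFormZMod p hm k).toAddMonoidHom (EisensteinCoeff.dualFamily p hm k i * x)) := by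
  let e : (Fin m → ZMod (p ^ k)) ≃ (Fin m → G) := Equiv.piCongrRight fun _ => Equiv.ofBijective exp hexp
  have h : (fun x : EisensteinCoeff p m k => fun i : Fin m =>
      exp ((EisensteinCoeff.tailFormZMod p hm k).toAddMonoidHom (EisensteinCoeff.dualFamily p hm k i * x))) =
      e ∘ fun x : EisensteinCoeff p m k => fun i : Fin m =>
        EisensteinCoeff.tailFormZMod p hm k (EisensteinCoeff.dualFamily p hm k i * x) := rfl
  rw [h]
  exact e.bijective.comp (EisensteinCoeff.bijective_tailFormZMod_dualFamily_mul p hm k)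

end Literature.NumberTheory.EllipticCurves.IwasawaAlgebra
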